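import Mathlib
import HarnessLib
import HarnessLib.Audit
import Summits.MatrixMultiplication.Statement
import Literature.Computability.AlgebraicComplexity.AsymptoticSpectrum
import Literature.Computability.AlgebraicComplexity.MatrixMultiplicationExponent
import Literature.Computability.AlgebraicComplexity.SchoenhageTau
import Literature.Barriers.MatrixMultiplication.UniversalMethodBarrier
import Literature.Computability.AlgebraicComplexity.AsymptoticSumInequalityAsymptoticRank
import Literature.Barriers.MatrixMultiplication.UniversalMethodBarrierAsymptoticRank
import Literature.Computability.AlgebraicComplexity.FlatteningBound
import HarnessLib.Audit.Status.Attr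

/-!
Route: CartanCubic

DORMANT since 2026-08-23T02:05:18Z (reconciler: no traction for 5.9 d (last activity item-evidence-added at 2026-08-17T05:03:07Z); parked, not closed — `ledger route dormant route-MatrixMultiplication-CartanCubic --off` to reactivate) — unstaffed, not closed; items shared with open routes are served there. `ledger route dormant <id> --off` reactivates.

# Route CartanCubic — the 27 lines multiply matrices — flatness plus matrix-multiplication value of
Cartan's E6 cubic forces omega = 2, and flatness alone already reads omega <= 2.2675

X_E6 (realises card e6-cubic-27-lines-two-matrix-products, its only card). Let J ∈ (ℂ²⁷)^⊗3 be SIX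
TIMES the full
polarisation of Cartan's E₆-invariant cubic in the SL₃×SL₃×SL₃ model ℂ²⁷ = M₃ ⊕ M₃ ⊕ M₃
(Manivel2006, DuffFerrara2007):
N(X,Y,Z) = det X + det Y + det Z − tr(XYZ); index a = (block, (row, col)) ∈ Fin 3 × (Fin 3 × Fin 3);
entries:
ε(rows)·ε(cols) ∈ {0,±1} on the three diagonal block cells (the polarised determinants D = ε₃ ⊠ ε₃ =
det₃ of
ConnerGesmundoLandsbergVentura2022), −1 on the six permutation cells at the index pattern of
tr(m₁m₂m₃) (even cells)
resp. tr(m₁m₃m₂) (odd cells), 0 elsewhere — 270 nonzero entries, symmetric, concise, stabiliser e₆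
(dim 78, irreducible
on each leg; all checked by exact linear algebra this session). It suffices to show X_E6 = X_flat ∧
X_val:
X_flat (E6Flat): R~(J) ≤ 27, i.e. J is asymptotically flat — the E₆-symmetric instance of the
(non-abelian) asymptotic
rank conjecture; and X_val (E6ThreeProducts): the Kronecker powers of J degenerate into disjoint
matrix products at the
PERFECT rate — for every ε > 0 some J^⊠N degenerates (over ℂ[λ]) to k disjoint copies of ⟨m,m,m⟩
with m ≥ 3^((1−ε)N)
and k·m² ≥ 27^((1−ε)N) ("J is asymptotically three matrix products": the model case is 3^K copies of
⟨3^K,3^K,3^K⟩,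
K ≥ (1−ε)N). X_flat alone is the card's thesis and already certifies a record: ω ≤ log₉(729/5) ≈
2.2675 via the
five products found in J^⊠2 this session (E6SquareFiveProducts, E6Thermometer), sharpening the
card's log₃ 13.5 ≈ 2.3691.
Lean: `let J : Fin 3 × (Fin 3 × Fin 3) → Fin 3 × (Fin 3 × Fin 3) → Fin 3 × (Fin 3 × Fin 3) → ℂ :=
fun a b c => if a.1 = b.1 ∧ b.1 = c.1 then ((if b.2.1 = a.2.1 + 1 ∧ c.2.1 = a.2.1 + 2 then (1 : ℂ)
else 0) - (if b.2.1 = a.2.1 + 2 ∧ c.2.1 = a.2.1 + 1 then 1 else 0)) * ((if b.2.2 = a.2.2 + 1 ∧ c.2.2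
= a.2.2 + 2 then (1 : ℂ) else 0) - (if b.2.2 = a.2.2 + 2 ∧ c.2.2 = a.2.2 + 1 then 1 else 0)) else if
b.1 = a.1 + 1 ∧ c.1 = a.1 + 2 then (if a.2.2 = b.2.1 ∧ b.2.2 = c.2.1 ∧ c.2.2 = a.2.1 then -1 else 0)
else if b.1 = a.1 + 2 ∧ c.1 = a.1 + 1 then (if a.2.2 = c.2.1 ∧ c.2.2 = b.2.1 ∧ b.2.2 = a.2.1 then -1
else 0) else 0; Literature.Computability.AlgebraicComplexity.asymptoticRank J ≤ 27 ∧ (∀ ε : ℝ, 0 < ε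
→ ∃ N k m : ℕ, 1 ≤ N ∧ (3 : ℝ) ^ ((1 - ε) * N) ≤ m ∧ (27 : ℝ) ^ ((1 - ε) * N) ≤ (k : ℝ) * (m : ℝ) ^
2 ∧ Literature.Barriers.MatrixMultiplication.PolyDegeneratesTo
(Literature.Computability.AlgebraicComplexity.kroneckerPow J N)
(Literature.Computability.AlgebraicComplexity.matMulDirectSum ℂ (fun _ : Fin k => m) (fun _ => m)
(fun _ => m)))`

## Assembly
Provable now from the cone, and PROVED in the planner's Sketch.lean (theorem `assembly_provable :
Assembly`, lean check rc 0, sorry-free,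
axioms propext/Classical.choice/Quot.sound; ~70 lines a prover can copy): given E6Flat and
E6ThreeProducts, fix ε ∈ (0,1) and take N, k, m and the
degeneration J^⊠N ⊵ D := ⊕_(i<k) ⟨m,m,m⟩. Then k·m^ω = Σ_(i<k) (m·m·m)^(ω/3) ≤ R~(D)
(`sum_rpow_omega_le_asymptoticRank`) ≤ R~(J^⊠N)
(`asymptoticRank_le_of_polyDegeneratesTo`) ≤ R~(J)^N (`asymptoticRank_kroneckerPow_le`) ≤ 27^N
(E6Flat). With k·m² ≥ 27^((1−ε)N) and
m ≥ 3^((1−ε)N) ≥ 1 this gives m^(ω−2) ≤ 27^(εN), i.e. (ω − 2)(1 − ε) ≤ 3ε; letting ε → 0, ω ≤ 2, and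
`two_le_omega`
(Theorems/AsymptoticSpectrumOmegaGeTwo.lean) closes ω(ℂ) = 2 = MatrixMultiplication
(`MatrixMultiplication_iff`).

Rationale: WHY THIS LINE. Mechanism: Schönhage's asymptotic sum inequality in asymptotic-rank form (PROVED in
tree: `sum_rpow_omega_le_asymptoticRank`,
AlmanDuanVassilevskaWilliamsXuXuZhou2025 Thm 3.1 / BurgisserClausenShokrollahi1997 Ex. 15.24(7))
turns "k disjoint ⟨m,m,m⟩
inside a degeneration of J^⊠N" plus "R~(J) ≤ 27" into k·m^ω ≤ 27^N; with the perfect rate this is ω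
= 2, with the rates
already in hand (2 copies of ⟨3,3,3⟩ in J by the card's chiral derangement zeroing; 5 copies of
⟨9,9,9⟩ in J^⊠2 by a
block-monomial degeneration found this session, where zeroing alone gives only 4) it is ω ≤ 2.3691
resp. ω ≤ 2.2675 —
so J is, after cw₂ (CoppersmithWinograd1990: R~(cw₂) = 3 ⇒ ω = 2; arXiv:2605.21738: R~(cw₂) < 3.931)
and det₃, a fixed small
tensor whose flatness has teeth, and (next to NonabelianARC's ω-free G₂ rung) the only such one
whose stabiliser is an EXCEPTIONAL group acting irreducibly (Schur ⇒
scalar quantum marginals ⇒ every quantum functional equals 27 (ChristandlVranaZuiddam2023), tight in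
the E₆-weight basis ⇒
Q~(J) = 27 (Strassen1991): no known spectral point can see R~(J) > 27). Imported: the geometry of
the 27 lines / minuscule
E₆-module (Manivel2006: the trialitarian model det + det + det − tr; DuffFerrara2007: the three
blocks are the bipartite
qutrit systems of a triangle — literally the matrix-multiplication triangle), Kronecker-power
border-rank technology and
Koszul flattenings (ConnerGesmundoLandsbergVentura2022, ConnerHarperLandsberg2019,
LandsbergOttaviani2015: bR(J) ≥ 47
computed this session), tri-coloured sum-free capacity (KleinbergSawinSpeyer2018) as the ceiling of
block-monomial
extraction, and the 2026 speedup theorems (arXiv:2605.21738) as the engine for pushing R~ below bR.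
What it does that
route NonabelianARC (ω-free 3j ladder; lists the E₆ cubic only as "further rung, not decomposed")
and AsymptoticRankCW /
HessianPlane (3×3×3 carriers; Hesse configuration as SUPPORT) do not: an NA-ARC instance in format
27 with a loss-free
matrix-multiplication extraction, a summit assembly through the value crux, and finite sign-of-life
cruxes on both the
flatness and the value side; negatives index empty at filing.

RANKED CRUXES. #2 E6Flat (crux) — Card item C1. The Cartan cubic tensor is asymptotically flat:
R~(J) ≤ 27 (hence = 27 by E6LowerFrame). The E₆-symmetric instance of NA-ARC (route NonabelianARC)
and of Strassen's ARC (J is tight and concise). Consequences already wired: ω ≤ 2.3691 (2 products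
in J), ω ≤ 2.2675 (5 products in J^⊠2, E6Thermometer); with E6ThreeProducts, ω = 2. [difficulty:
open-problem] (why it might fail: False if ω > log₉(729/5) ≈ 2.2675 (then J is a dark point in
format 27: every quantum functional is 27 but R~(J) > 27); needs bR(J^⊠N)^(1/N) to fall from bR(J) ≥
47 (Koszul, this session) to 27, a 43% drop never certified for any tensor.)
[ConnerGesmundoLandsbergVenturaWang2020, ConnerGesmundoLandsbergVentura2022,
ChristandlVranaZuiddam2023, Strassen1991, arXiv:2605.21738, Manivel2006]
#3 E6ThreeProducts (crux) — Card item C3 pushed to the summit rate ("J is asymptotically three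
matrix products"): for every ε > 0 there are N ≥ 1, k, m with m ≥ 3^((1−ε)N), k·m² ≥ 27^((1−ε)N) and
a degeneration J^⊠N ⊵ ⊕_(i<k) ⟨m,m,m⟩ (PolyDegeneratesTo, over ℂ[λ]). Model case 3^K ⊙
⟨3^K,3^K,3^K⟩, K ≥ (1−ε)N; at N = 1 exactly 2 < 3 copies exist (closed-orbit argument: J and
⟨3,3,3⟩^⊕3 are both critical in the same format, not isomorphic), at N = 2 at least 5 and at most 8.
[difficulty: open-problem] (why it might fail: Block-monomial (laser) extraction over the Hesse
outer support is capped by the tri-coloured sum-free capacity 2.7551^N ≪ 3^N, so the perfect rate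
needs E₆-mixing, non-monomial degenerations nobody has exhibited; given Q~(J) = 27 it is implied by
ω = 2, so no cheap refutation either.) [KleinbergSawinSpeyer2018,
BlasiakChurchCohnGrochowNaslundSawinUmans2017, CoppersmithWinograd1990, Strassen1991,
ChristandlVranaZuiddam2023, Schonhage1981]
#4 E6PowerDrop (crux) — First sign of life for E6Flat: border rank is strictly submultiplicative on
some Kronecker power of J — ∃ N ≥ 1, bR(J^⊠N) < bR(J)^N (algebraic border rank over ℂ[λ]);
equivalently R~(J) < bR(J). Route to it: determine bR(J) (47 ≤ bR(J) ≤ 171 = 3·bR(det₃) +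
6·bR(⟨3,3,3⟩), ConnerGesmundoLandsbergVentura2022 + Smirnov2013), then either an explicit ε-scheme
for J^⊠2 in format 729 of rank < bR(J)², or a speedup theorem fed with E6TwoProducts /
E6SquareFiveProducts (arXiv:2605.21738 does exactly this for cw₂: R~(cw₂) < 3.931 < 4). [difficulty:
L] (why it might fail: Squares and cubes can be border-rank multiplicative (bR(cw_q^⊠2) = (q+2)² for
q > 2, bR(cw_q^⊠3) = (q+2)³ for q > 4, CGLV 2022); bR(J) itself is unknown in [47,171], and format
729 at rank ≈ 2200 is beyond certified numerics, so only a structural (E₆-equivariant or speedup)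
argument lands it.) [arXiv:2605.21738, ConnerGesmundoLandsbergVentura2022, ConnerHuangLandsberg2020,
ConnerHarperLandsberg2019, LandsbergOttaviani2015, Smirnov2013]
#9 E6TwoProducts (support) — Card item S1 (the chiral derangement zeroing, re-verified this
session): zeroing the X-block on leg 1, the Y-block on leg 2 and the Z-block on leg 3 kills the
three determinant cells and four of the six trace cells; the survivors (Y,Z,X) and (Z,X,Y) sit on
disjoint blocks in every leg and each is a copy of ⟨3,3,3⟩, so J restricts to ⟨3,3,3⟩ ⊕ ⟨3,3,3⟩.
With `sum_rpow_omega_le_asymptoticRank` and monotonicity: 2·3^ω ≤ R~(J). [difficulty: provable-now]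
[Schonhage1981, BurgisserClausenShokrollahi1997, Manivel2006]
#9 E6SquareFiveProducts (support) — New this session: the Kronecker square J^⊠2 degenerates
(block-monomial degeneration, hence PolyDegeneratesTo) to FIVE disjoint copies of ⟨9,9,9⟩, one more
than zeroing allows (4 = 2²) and the maximum for block-monomial degenerations (exhaustive LP check;
9 is impossible for any degeneration by criticality). Certificate (blocks of J^⊠2 = pairs in Z₃²,
legs 1/2/3): keep cells ((0,0),(1,1),(2,2)), ((0,1),(1,2),(2,0)), ((0,2),(2,0),(1,1)),
((1,0),(0,2),(2,1)), ((2,1),(0,0),(1,2)); zero every other block; λ-weights u = (00↦0, 01↦0, 02↦1,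
10↦3, 21↦0) on leg 1, v = (00↦4, 02↦0, 11↦4, 12↦4, 20↦5) on leg 2, w = (11↦0, 12↦2, 20↦2, 21↦3,
22↦2) on leg 3: the five kept cells have total weight 6, the nine other surviving Hesse cells have
weight ≥ 7. Hence 5·9^ω ≤ R~(J)². [difficulty: provable-now] [CoppersmithWinograd1990, Strassen1991,
BurgisserClausenShokrollahi1997]
#9 E6Thermometer (support) — The record dial of the line, unconditional: ω ≤ log₉(R~(J)²/5) (from
E6SquareFiveProducts, the proved asymptotic-rank ASI, `asymptoticRank_le_of_polyDegeneratesTo` and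
`asymptoticRank_kroneckerPow_le`). Readings: R~(J) = 27 ⇒ ω ≤ 2.2675; any certified R~(J) < 30.26
beats 2.371339 (AlmanDuanVassilevskaWilliamsXuXuZhou2025); the trivial R~(J) ≤ 27^(2ω/3)
(Strassen1988) reads nothing. [difficulty: provable-now] [AlmanDuanVassilevskaWilliamsXuXuZhou2025,
Schonhage1981, Strassen1988, Blaser2013]
#9 E6LowerFrame (support) — Lower frame making "flat" mean "= 27": 27 ≤ R~(J), from conciseness (all
three flattening ranks are 27, exact computation this session) and
`flatteningRank_le_asymptoticRank` (in tree). [difficulty: provable-now]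
[ChristandlVranaZuiddam2023, BurgisserClausenShokrollahi1997]
#9 E6KoszulBound (support) — Calibration of the drop E6Flat needs: bR(J) ≥ 47, by the
Landsberg–Ottaviani Koszul flattening with p = 3 on a generic 7-dimensional quotient of leg 1
(matrix 945 × 945 of rank ≥ 924, computed mod 1000003 this session; 924/20 = 46.2); p = 1, 2 give 39
and 45; larger p can certify at most 52. A rank certificate in Lean (the tree has Koszul-flattening
infrastructure: KoszulFlatteningBorderRank, BorderRankCWKoszul*). [difficulty: M]
[LandsbergOttaviani2015, ConnerHarperLandsberg2019, ConnerGesmundoLandsbergVentura2022]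

TWO-LAYER PLAN. Foreseen glued splits (nothing filed now). E6Flat ⇐ E6PowerDecay →
BorderToAsymptotic → E6Flat, with E6PowerDecay = "∀ ε > 0 ∃ N ≥ 1,
bR(J^⊠N) ≤ (27+ε)^N" (the constructive content; E6PowerDrop is its first instance) and
BorderToAsymptotic = "R~(t) ≤ bR(t^⊠N)^(1/N)" (in tree:
`asymptoticRank_le_of_algBorderRank_le`, `asymptoticRank_kroneckerPow_le`). E6ThreeProducts ⇐
E6LaserRate → E6MixingBoost → E6ThreeProducts,
with E6LaserRate = the optimal BLOCK-MONOMIAL rate c_J^N of disjoint ⟨3^N,3^N,3^N⟩ in J^⊠N (a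
tri-coloured-sum-free-type capacity of the Hesse
outer support with determinant cells forbidden; √5 ≤ c_J ≤ 2.7551, card item C3; flat ⇒ ω ≤ 3 − log₃
c_J ∈ [2.0775, 2.2675]) and
E6MixingBoost = the non-monomial step from c_J to 3 using the determinant cells and E₆. E6PowerDrop
⇐ (bR(J) = β, exact) → (bR(J^⊠2) < β²).

KILL CRITERIA. ω(ℂ) > log₉(729/5) ≈ 2.2675 proved anywhere (routes BorderRankLowerBound,
NilCoxeterShadow, BrentRefutationDepth, FidelityWitnesses aim far lower)
refutes E6Flat: close `refuted:E6Flat` (the census then records J as an explicit dark point in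
format 27 — BCS Problem 15.5 answered negatively —
which is itself news). A certified spectral point F with F(J) > 27 does the same. E6ThreeProducts
refuted (a spectral obstruction to
J^⊠N ⊵ 3^((1−ε)N) ⊙ ⟨3^N,…⟩ beyond the quantum functionals) while E6Flat stands: the summit assembly
dies, pivot the route to the record line
(E6Flat ∧ E6LaserRate, assembly to a named ω-bound) or close `superseded` in favour of NonabelianARC
with J filed there as a rung. Border rank
multiplicative on the square AND the cube of J (E6PowerDrop stuck with bR(J^⊠2) = bR(J)², bR(J^⊠3) =
bR(J)³ certified): close `exhausted`
with census. ω = 2 proved elsewhere moots the assembly; E6Flat then survives as a Literature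
conjecture card (NA-ARC instance).

NOT DECOMPOSED YET. The ENGINE for E6Flat (card item C2): J^⊠N spans the one-dimensional space of
E₆^N-invariants in its format, so any E₆^N-equivariant degeneration
from a unit tensor with non-zero invariant component hits ℂ·J^⊠N exactly — orbit designs under
finite subgroups (Hessian groups 3^(1+2) in each
SL₃ factor, W(E₆) monomially, ⋊ S_N) and border apolarity with the growing Borel; no stabiliser /
invariant-theory API in Lean, and as a
statement it is E6Flat restated, so it rides as the mechanism, not as an item. The exact constant
c_J of E6LaserRate (a finite-alphabet capacity
problem: Hesse outer support, determinant cells forbidden, realisability by monomial degeneration =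
an LP per pattern) — a kit computation for
whoever takes the value side; filed only once E6Flat or E6PowerDrop shows life. The value of the
determinant cell D = det₃ (does D ⊵ ⟨2,2,2⟩ or
⟨3,3,1⟩? it would raise c_J) — later child of E6ThreeProducts. The exact bR(J) (Koszul can certify ≤
52; the truth is plausibly 50–80) and
bR(J^⊠2) — data for E6PowerDrop, not items. The D₅-blocking 27 = 1 + 10 + 16 (N = λ·q(v) + ⟨v, s·s⟩:
a quadratic form cell and the half-spin
Clifford multiplication cell) as an alternative zeroing geometry — unexplored. The negative side
¬E6Flat (J dark) is NOT filed: no known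
technique produces a spectral point above the flattening rank on a critical tensor (it is
NonabelianARC's NAARCCounterexample territory).

CHEAPEST FALSIFIER. Run this session (exact arithmetic, folder calc/): (i) is the explicit J really
Cartan's cubic? — stabiliser of the cubic in gl₂₇ has
dimension 78 = 24 + 27 + 27 (ℤ₃-graded: sl₃³ plus two 27-dimensional pieces), commutant ℂ
(irreducible), 3-leg stabiliser 80 = e₆ + 2;
with +tr(XYZ) instead of −tr(XYZ) the stabiliser collapses to sl₃³ (24), so the sign in the Lean
term is load-bearing and correct;
(ii) support 270, uniform marginals 10, flattening ranks 27/27/27; (iii) the derangement zeroing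
leaves exactly the cells (Y,Z,X), (Z,X,Y)
with 27 entries each; (iv) block-level extraction census: N = 1 max 2, N = 2 zeroing max 4,
block-monomial max 5 (certificate in
E6SquareFiveProducts), 6 infeasible; (v) Koszul p = 1,2,3: bR(J) ≥ 39, 45, 47. Next cheapest, not
run (kit daemon absent on this host):
(a) Koszul p = 4..6 / full p = 13 with E₆-weights (can reach 52); (b) numerical border-rank search
for J (format 27, r = 47…60);
(c) feed "J ⊵ 2⟨3,3,3⟩, bR(J) ≤ r" into the speedup theorem of arXiv:2605.21738 §3 — if it yields
R~(J) < r, E6PowerDrop falls at once;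
(d) does det₃ = ε₃^⊠2 degenerate to ⟨2,2,2⟩ (raises c_J)?

NUMBERS. ω < 2.371339 (AlmanDuanVassilevskaWilliamsXuXuZhou2025). Flat J reads: log₃ 13.5 = 2.36907
(N = 1, 2 products), log₉ 145.8 = 2.26751
(N = 2, 5 products), 3 − log₃ c_J ∈ [2.0775, 2.2675] (block-monomial limit, c_J ∈ [√5, 2.7551]), 2
(E6ThreeProducts). Record thresholds:
R~(J) < 27.07 (N = 1 dial), R~(J) < 30.26 (N = 2 dial). Known: 27 ≤ R~(J) ≤ min(bR(J), 27^(2ω/3) ≈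
183); 47 ≤ bR(J) ≤ 171; R(J) ≤ 180
(45 squarefree monomials of Waring rank 4); bR(det₃) = 17 (≤ ConnerGesmundoLandsbergVentura2022 /
ConnerHuangLandsberg2020 §8, ≥ ConnerHarperLandsberg2019),
bR(⟨3,3,3⟩) ∈ [17, 20] (ConnerHarperLandsberg2023, Smirnov2013). Stabiliser data: dim 78 / commutant
1 / 3-leg 80; support 270 = 3·36 + 6·27, marginals 10;
every quantum functional F_θ(J) = 27 and Q~(J) = 27 (critical + tight). Block-extraction census of
⟨3^N,3^N,3^N⟩'s: N = 1: 2 (zeroing =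
monomial = 2, 3 impossible); N = 2: zeroing 4, monomial 5, any degeneration ≤ 8. Items at open: 9 (3
cruxes, 5 support, 1 assembly).

DEFINITION REQUESTS. None blocking (J is inlined by a closed `let`, as in routes NonabelianARC /
HessianPlane). Nice to have: `cartanCubicTensor : Fin 3 × (Fin 3 ×
Fin 3) → … → ℂ` under Summits/MatrixMultiplication/MatrixMultiplication/Theorems so the eight items
can drop the `let`; a `blockMonomialDegeneration`
helper (weights on blocks ⇒ PolyDegeneratesTo) would serve E6SquareFiveProducts and every laser-type
support item of AsymptoticRankCW /
HessianPlane alike. Bib entries prepared in folder refs.bib (Manivel2006, DuffFerrara2007,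
KleinbergSawinSpeyer2018; `ledger bib add` timed out
once this session — to be retried); arXiv:2605.21738 (speedup theorems, 2026) has no Crossref DOI
yet and is cited by arXiv id.

Novelty: Searches (2026-08-15): `lit galaxy search "Cartan cubic" --star all` (1 hit: Abuaf arXiv:2105.02982,
geometry); `lit galaxy search "det X + det Y + det Z" --star all` (0); `lit galaxy search
"exceptional Jordan algebra" --star pdf` (15, none on complexity); `lit galaxy search "Waring rank
of the Cartan cubic" --star pdf --mode bm25` (15 generic Waring-rank hits, none on E₆); `lit search
--source zbmath "Cartan cubic rank"` (14 geometric hits: Iliev–Manivel arXiv:1102.3618,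
Kim–Schreyer, …; none on tensor/border/asymptotic rank); `lit search --source zbmath "Waring rank
invariant cubic E6 27 variables"` (0); `lit frontier MatrixMultiplication --since 2022` (30 rows;
read arXiv:2605.21738 pp. 1–4: speedup theorems, R~(cw₂) < 3.931, general bound below d^(2ω/3) — no
symmetric/exceptional instances); local searchd / OpenAlex / S2 / arXiv APIs unavailable or
rate-limited (HTTP 429) this session, recorded in NOTES.md; the card's own audit (CGLV
arXiv:1909.04785 §2.3, CGLVW pp. 1–5: ARC instances in formats 3–4 only) re-used.
Nearest prior art found: ConnerGesmundoLandsbergVentura2022 (arXiv:1909.04785) §2.3 +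
ConnerGesmundoLandsbergVenturaWang2020 — small symmetric tensors (cw₂, skew-cw₂, det₃) whose
flatness bears on ω, with Kronecker-power border ranks; Manivel2006 / DuffFerrara2007 — the model N
= det X + det Y + det Z − tr(XYZ) of the E₆ cubic, no complexity content; route NonabelianARC (this
hub) — NA-ARC on the 3j ladder, E₆ deferred.
Delta: first complexity reading of the E₆  [refs: 2105.02982, 1102.3618, 2605.21738, 1909.04785, ConnerGesmundoLandsbergVentura2022, ConnerGesmundoLandsbergVenturaWang2020, Manivel2006, DuffFerrara2007]

Barriers (technique_class: asymptotic-rank-conjecture, exceptional-tensor-flatness): - technique_class: asymptotic-rank-conjecture, exceptional-tensor-flatness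
- Literature.Barriers.MatrixMultiplication.IrreversibilityBarrier: met head-on, not evaded — J is
balanced (Q~(J) = 27 = every quantum functional), so its irreversibility is i(J) = log₂₇ R~(J) and
CVZ Thm 9 caps any ω-bound through J at 2·i(J); the bet E6Flat is exactly i(J) = 1, where the cap is
2 and the barrier is void; a certified R~(J) = r > 27 would turn the barrier into the kill criterion
(best possible 2 log₂₇ r).
- Literature.Barriers.MatrixMultiplication.UniversalMethodBarrier: Alman's ω_u bound is for CW_q /
cw_q-type starting tensors; for J the same monomial-degeneration accounting is what caps
BLOCK-monomial extraction (E6LaserRate ≤ 2.7551^N, floor 2.0775 even if flat) — acknowledged in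
E6ThreeProducts' why-it-might-fail: the summit needs non-monomial degenerations, the record does
not.
- Literature.Barriers.MatrixMultiplication.TricoloredSumFreeBarrier: applies to the value side only
— disjoint block cells extracted from the Hesse^N outer support form a tri-coloured sum-free set in
(Z₃^N)³, hence ≤ 2.7551^N; the main extraction (2 per coordinate, 5 per pair) lives far below the
cap and the flatness crux is untouched.
- Literature.Barriers.MatrixMultiplication.InfimumNotMinimumBarrier: respected — bR(J) ≥ 47 > 30.26,
so no finite border identity for J can certify a record, let alone flatness; every ω-relevant item
is an asymptotic-rank / Kronecker-power statement.
- Literature.Barriers.Ma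

Novelty grade: variant — ROUTE-REVIEW grade (refuter 2c4772d4, 2026-08-15): variant = fixed-tensor flatness mechanism (ARC instance for one small symmetric tensor + Schönhage ASI + Kronecker-power extraction ⇒ ω bound), published for cw₂/det₃ (CGLVW2020; CGLV2022 §2.3; CW1990 §11) and routed in-hub (AsymptoticRankCW/Hessian (refuter refuter-rreview-route-HubbardSuperconduc-2c4772d4-0, 2026-08-15T13:52:40Z; prior: ConnerGesmundoLandsbergVenturaWang2020, ConnerGesmundoLandsbergVentura2022, CoppersmithWinograd1990, Strassen1991, Manivel2006, DuffFerrara2007, route-MatrixMultiplication-NonabelianARC, route-MatrixMultiplication-AsymptoticRankCW)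

History (route lifecycle, newest last):
- 2026-08-23T02:05:18Z · DORMANT — reconciler: no traction for 5.9 d (last activity item-evidence-added at 2026-08-17T05:03:07Z); parked, not closed — `ledger route dormant route-MatrixMultiplica (operator:999:2610331)

sub-problem: MatrixMultiplication · status: dormant · opened planner-plancard-MatrixMultiplication-MatrixM-7c878e51-0 2026-08-15T12:32:01Z · rev 1 · ledger route-MatrixMultiplication-CartanCubic
GENERATED by the gate from the ledger (D-0016/17). Provers cite these decls: `theorem foo : Summit.MatrixMultiplication.MatrixMultiplication.Theses.CartanCubic.<Decl> := …` in Summits/MatrixMultiplication/MatrixMultiplication/Theorems/<Name>.lean.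
-/

namespace Summit.MatrixMultiplication.MatrixMultiplication.Theses.CartanCubic

open scoped BigOperators Topology Manifold Classical MeasureTheory ProbabilityTheory Matrix InnerProductSpace ComplexConjugate ContinuousMap
open Filter Set Function TopologicalSpace MeasureTheory

attribute [summit_statement] _root_.MatrixMultiplication

/-- item stmt-MatrixMultiplication-8156 · crux · rank 2 · open · by planner
why it might fail: False if ω > log₉(729/5) ≈ 2.2675 (then J is a dark point in format 27: every quantum functional is 27 but R~(J) > 27); needs bR(J^⊠N)^(1/N) to fall from bR(J) ≥ 47 (Koszul, this session) to 27, a 43% drop never certified for any tensor.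
sources: ConnerGesmundoLandsbergVenturaWang2020, ConnerGesmundoLandsbergVentura2022, ChristandlVranaZuiddam2023, Strassen1991, arXiv:2605.21738, Manivel2006
[crux] Card item C1. The Cartan cubic tensor is asymptotically flat: R~(J) ≤ 27 (hence = 27 by
E6LowerFrame). The E₆-symmetric instance of NA-ARC (route NonabelianARC) and of Strassen's ARC (J is
tight and concise). Consequences already wired: ω ≤ 2.3691 (2 products in J), ω ≤ 2.2675 (5 products
in J^⊠2, E6Thermometer); with E6ThreeProducts, ω = 2. [difficulty: open-problem] -/
@[route_item "route-MatrixMultiplication-CartanCubic", crux]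
def E6Flat : Prop :=
  let J : Fin 3 × (Fin 3 × Fin 3) → Fin 3 × (Fin 3 × Fin 3) → Fin 3 × (Fin 3 × Fin 3) → ℂ := fun a b c => if a.1 = b.1 ∧ b.1 = c.1 then ((if b.2.1 = a.2.1 + 1 ∧ c.2.1 = a.2.1 + 2 then (1 : ℂ) else 0) - (if b.2.1 = a.2.1 + 2 ∧ c.2.1 = a.2.1 + 1 then 1 else 0)) * ((if b.2.2 = a.2.2 + 1 ∧ c.2.2 = a.2.2 + 2 then (1 : ℂ) else 0) - (if b.2.2 = a.2.2 + 2 ∧ c.2.2 = a.2.2 + 1 then 1 else 0)) else if b.1 = a.1 + 1 ∧ c.1 = a.1 + 2 then (if a.2.2 = b.2.1 ∧ b.2.2 = c.2.1 ∧ c.2.2 = a.2.1 then -1 else 0) else if b.1 = a.1 + 2 ∧ c.1 = a.1 + 1 then (if a.2.2 = c.2.1 ∧ c.2.2 = b.2.1 ∧ b.2.2 = a.2.1 then -1 else 0) else 0; Literature.Computability.AlgebraicComplexity.asymptoticRank J ≤ 27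

/-- item stmt-MatrixMultiplication-8157 · crux · rank 3 · open · by planner
why it might fail: Block-monomial (laser) extraction over the Hesse outer support is capped by the tri-coloured sum-free capacity 2.7551^N ≪ 3^N, so the perfect rate needs E₆-mixing, non-monomial degenerations nobody has exhibited; given Q~(J) = 27 it is implied by ω = 2, so no cheap refutation either.
sources: KleinbergSawinSpeyer2018, BlasiakChurchCohnGrochowNaslundSawinUmans2017, CoppersmithWinograd1990, Strassen1991, ChristandlVranaZuiddam2023, Schonhage1981
[crux] Card item C3 pushed to the summit rate ("J is asymptotically three matrix products"): for
every ε > 0 there are N ≥ 1, k, m with m ≥ 3^((1−ε)N), k·m² ≥ 27^((1−ε)N) and a degeneration J^⊠N ⊵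
⊕_(i<k) ⟨m,m,m⟩ (PolyDegeneratesTo, over ℂ[λ]). Model case 3^K ⊙ ⟨3^K,3^K,3^K⟩, K ≥ (1−ε)N; at N = 1
exactly 2 < 3 copies exist (closed-orbit argument: J and ⟨3,3,3⟩^⊕3 are both critical in the same
format, not isomorphic), at N = 2 at least 5 and at most 8. [difficulty: open-problem] -/
@[route_item "route-MatrixMultiplication-CartanCubic", crux]
def E6ThreeProducts : Prop :=
  let J : Fin 3 × (Fin 3 × Fin 3) → Fin 3 × (Fin 3 × Fin 3) → Fin 3 × (Fin 3 × Fin 3) → ℂ := fun a b c => if a.1 = b.1 ∧ b.1 = c.1 then ((if b.2.1 = a.2.1 + 1 ∧ c.2.1 = a.2.1 + 2 then (1 : ℂ) else 0) - (if b.2.1 = a.2.1 + 2 ∧ c.2.1 = a.2.1 + 1 then 1 else 0)) * ((if b.2.2 = a.2.2 + 1 ∧ c.2.2 = a.2.2 + 2 then (1 : ℂ) else 0) - (if b.2.2 = a.2.2 + 2 ∧ c.2.2 = a.2.2 + 1 then 1 else 0)) else if b.1 = a.1 + 1 ∧ c.1 = a.1 + 2 then (if a.2.2 = b.2.1 ∧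 b.2.2 = c.2.1 ∧ c.2.2 = a.2.1 then -1 else 0) else if b.1 = a.1 + 2 ∧ c.1 = a.1 + 1 then (if a.2.2 = c.2.1 ∧ c.2.2 = b.2.1 ∧ b.2.2 = a.2.1 then -1 else 0) else 0; ∀ ε : ℝ, 0 < ε → ∃ N k m : ℕ, 1 ≤ N ∧ (3 : ℝ) ^ ((1 - ε) * N) ≤ m ∧ (27 : ℝ) ^ ((1 - ε) * N) ≤ (k : ℝ) * (m : ℝ) ^ 2 ∧ Literature.Barriers.MatrixMultiplication.PolyDegeneratesTo (Literature.Computability.AlgebraicComplexity.kroneckerPow J N) (Literature.Computability.AlgebraicComplexity.matMulDirectSum ℂ (fun _ : Fin k => m) (fun _ => m) (fun _ => m))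

/-- item stmt-MatrixMultiplication-8158 · crux · rank 4 · open · by planner
why it might fail: Squares and cubes can be border-rank multiplicative (bR(cw_q^⊠2) = (q+2)² for q > 2, bR(cw_q^⊠3) = (q+2)³ for q > 4, CGLV 2022); bR(J) itself is unknown in [47,171], and format 729 at rank ≈ 2200 is beyond certified numerics, so only a structural (E₆-equivariant or speedup) argument lands it.
sources: arXiv:2605.21738, ConnerGesmundoLandsbergVentura2022, ConnerHuangLandsberg2020, ConnerHarperLandsberg2019, LandsbergOttaviani2015, Smirnov2013
[crux] First sign of life for E6Flat: border rank is strictly submultiplicative on some Kronecker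
power of J — ∃ N ≥ 1, bR(J^⊠N) < bR(J)^N (algebraic border rank over ℂ[λ]); equivalently R~(J) <
bR(J). Route to it: determine bR(J) (47 ≤ bR(J) ≤ 171 = 3·bR(det₃) + 6·bR(⟨3,3,3⟩),
ConnerGesmundoLandsbergVentura2022 + Smirnov2013), then either an explicit ε-scheme for J^⊠2 in
format 729 of rank < bR(J)², or a speedup theorem fed with E6TwoProducts / E6SquareFiveProducts
(arXiv:2605.21738 does exactly this for cw₂: R~(cw₂) < 3.931 < 4). [difficulty: L] -/
@[route_item "route-MatrixMultiplication-CartanCubic"]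
def E6PowerDrop : Prop :=
  let J : Fin 3 × (Fin 3 × Fin 3) → Fin 3 × (Fin 3 × Fin 3) → Fin 3 × (Fin 3 × Fin 3) → ℂ := fun a b c => if a.1 = b.1 ∧ b.1 = c.1 then ((if b.2.1 = a.2.1 + 1 ∧ c.2.1 = a.2.1 + 2 then (1 : ℂ) else 0) - (if b.2.1 = a.2.1 + 2 ∧ c.2.1 = a.2.1 + 1 then 1 else 0)) * ((if b.2.2 = a.2.2 + 1 ∧ c.2.2 = a.2.2 + 2 then (1 : ℂ) else 0) - (if b.2.2 = a.2.2 + 2 ∧ c.2.2 = a.2.2 + 1 then 1 else 0)) else if b.1 = a.1 + 1 ∧ c.1 = a.1 + 2 then (if a.2.2 = b.2.1 ∧ b.2.2 = c.2.1 ∧ c.2.2 = a.2.1 then -1 else 0) else if b.1 = a.1 + 2 ∧ c.1 = a.1 + 1 then (if a.2.2 = c.2.1 ∧ c.2.2 = b.2.1 ∧ b.2.2 = a.2.1 then -1 else 0) else 0; ∃ N : ℕ, 1 ≤ N ∧ Literature.Computability.AlgebraicComplexity.algBorderRank (Literature.Computability.AlgebraicComplexity.kroneckerPow J N) < Literature.Computability.AlgebraicComplexity.algBorderRank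 J ^ N

/-- item stmt-MatrixMultiplication-8159 · support · rank 9 · open · by planner
sources: Schonhage1981, BurgisserClausenShokrollahi1997, Manivel2006
[support] Card item S1 (the chiral derangement zeroing, re-verified this session): zeroing the
X-block on leg 1, the Y-block on leg 2 and the Z-block on leg 3 kills the three determinant cells
and four of the six trace cells; the survivors (Y,Z,X) and (Z,X,Y) sit on disjoint blocks in every
leg and each is a copy of ⟨3,3,3⟩, so J restricts to ⟨3,3,3⟩ ⊕ ⟨3,3,3⟩. With
`sum_rpow_omega_le_asymptoticRank` and monotonicity: 2·3^ω ≤ R~(J). [difficulty: provable-now] -/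
@[route_item "route-MatrixMultiplication-CartanCubic"]
def E6TwoProducts : Prop :=
  let J : Fin 3 × (Fin 3 × Fin 3) → Fin 3 × (Fin 3 × Fin 3) → Fin 3 × (Fin 3 × Fin 3) → ℂ := fun a b c => if a.1 = b.1 ∧ b.1 = c.1 then ((if b.2.1 = a.2.1 + 1 ∧ c.2.1 = a.2.1 + 2 then (1 : ℂ) else 0) - (if b.2.1 = a.2.1 + 2 ∧ c.2.1 = a.2.1 + 1 then 1 else 0)) * ((if b.2.2 = a.2.2 + 1 ∧ c.2.2 = a.2.2 + 2 then (1 : ℂ) else 0) - (if b.2.2 = a.2.2 + 2 ∧ c.2.2 = a.2.2 + 1 then 1 else 0)) else if b.1 = a.1 + 1 ∧ c.1 = a.1 + 2 then (if a.2.2 = b.2.1 ∧ b.2.2 = c.2.1 ∧ c.2.2 = a.2.1 then -1 else 0) else if b.1 = a.1 + 2 ∧ c.1 = a.1 + 1 then (if a.2.2 = c.2.1 ∧ c.2.2 = b.2.1 ∧ b.2.2 = a.2.1 then -1 else 0) else 0; Literature.Computability.AlgebraicComplexity.TensorRestrictsTo J (Literature.Computability.AlgebraicComplexity.matMulDirectSum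 ℂ ![3, 3] ![3, 3] ![3, 3])

/-- item stmt-MatrixMultiplication-8160 · support · rank 9 · open · by planner
sources: CoppersmithWinograd1990, Strassen1991, BurgisserClausenShokrollahi1997
[support] New this session: the Kronecker square J^⊠2 degenerates (block-monomial degeneration,
hence PolyDegeneratesTo) to FIVE disjoint copies of ⟨9,9,9⟩, one more than zeroing allows (4 = 2²)
and the maximum for block-monomial degenerations (exhaustive LP check; 9 is impossible for any
degeneration by criticality). Certificate (blocks of J^⊠2 = pairs in Z₃², legs 1/2/3): keep cells
((0,0),(1,1),(2,2)), ((0,1),(1,2),(2,0)), ((0,2),(2,0),(1,1)), ((1,0),(0,2),(2,1)),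
((2,1),(0,0),(1,2)); zero every other block; λ-weights u = (00↦0, 01↦0, 02↦1, 10↦3, 21↦0) on leg 1,
v = (00↦4, 02↦0, 11↦4, 12↦4, 20↦5) on leg 2, w = (11↦0, 12↦2, 20↦2, 21↦3, 22↦2) on leg 3: the five
kept cells have total weight 6, the nine other surviving Hesse cells have weight ≥ 7. Hence 5·9^ω ≤
R~(J)². [difficulty: provable-now] -/
@[route_item "route-MatrixMultiplication-CartanCubic"]
def E6SquareFiveProducts : Prop :=
  let J : Fin 3 × (Fin 3 × Fin 3) → Fin 3 × (Fin 3 × Fin 3) → Fin 3 × (Fin 3 × Fin 3) → ℂ := fun a b c => if a.1 = b.1 ∧ b.1 = c.1 then ((if b.2.1 = a.2.1 + 1 ∧ c.2.1 = a.2.1 + 2 then (1 : ℂ) else 0) - (if b.2.1 = a.2.1 + 2 ∧ c.2.1 = a.2.1 + 1 then 1 else 0)) * ((if b.2.2 = a.2.2 + 1 ∧ c.2.2 = a.2.2 + 2 then (1 : ℂ) else 0) - (if b.2.2 = a.2.2 + 2 ∧ c.2.2 = a.2.2 + 1 then 1 else 0)) else if b.1 = a.1 + 1 ∧ c.1 =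 a.1 + 2 then (if a.2.2 = b.2.1 ∧ b.2.2 = c.2.1 ∧ c.2.2 = a.2.1 then -1 else 0) else if b.1 = a.1 + 2 ∧ c.1 = a.1 + 1 then (if a.2.2 = c.2.1 ∧ c.2.2 = b.2.1 ∧ b.2.2 = a.2.1 then -1 else 0) else 0; Literature.Barriers.MatrixMultiplication.PolyDegeneratesTo (Literature.Computability.AlgebraicComplexity.kroneckerPow J 2) (Literature.Computability.AlgebraicComplexity.matMulDirectSum ℂ ![9, 9, 9, 9, 9] ![9, 9, 9, 9, 9] ![9, 9, 9, 9, 9])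

/-- item stmt-MatrixMultiplication-8161 · support · rank 9 · open · by planner
sources: AlmanDuanVassilevskaWilliamsXuXuZhou2025, Schonhage1981, Strassen1988, Blaser2013
[support] The record dial of the line, unconditional: ω ≤ log₉(R~(J)²/5) (from E6SquareFiveProducts,
the proved asymptotic-rank ASI, `asymptoticRank_le_of_polyDegeneratesTo` and
`asymptoticRank_kroneckerPow_le`). Readings: R~(J) = 27 ⇒ ω ≤ 2.2675; any certified R~(J) < 30.26
beats 2.371339 (AlmanDuanVassilevskaWilliamsXuXuZhou2025); the trivial R~(J) ≤ 27^(2ω/3)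
(Strassen1988) reads nothing. [difficulty: provable-now] -/
@[route_item "route-MatrixMultiplication-CartanCubic"]
def E6Thermometer : Prop :=
  let J : Fin 3 × (Fin 3 × Fin 3) → Fin 3 × (Fin 3 × Fin 3) → Fin 3 × (Fin 3 × Fin 3) → ℂ := fun a b c => if a.1 = b.1 ∧ b.1 = c.1 then ((if b.2.1 = a.2.1 + 1 ∧ c.2.1 = a.2.1 + 2 then (1 : ℂ) else 0) - (if b.2.1 = a.2.1 + 2 ∧ c.2.1 = a.2.1 + 1 then 1 else 0)) * ((if b.2.2 = a.2.2 + 1 ∧ c.2.2 = a.2.2 + 2 then (1 : ℂ) else 0) - (if b.2.2 = a.2.2 + 2 ∧ c.2.2 = a.2.2 + 1 then 1 else 0)) else if b.1 = a.1 + 1 ∧ c.1 = a.1 + 2 then (if a.2.2 = b.2.1 ∧ b.2.2 = c.2.1 ∧ c.2.2 = a.2.1 then -1 else 0) else if b.1 = a.1 + 2 ∧ c.1 = a.1 + 1 then (if a.2.2 = c.2.1 ∧ c.2.2 = b.2.1 ∧ b.2.2 = a.2.1 then -1 else 0) else 0; Literature.Computability.AlgebraicComplexity.omega ℂ ≤ Real.logb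 9 (Literature.Computability.AlgebraicComplexity.asymptoticRank J ^ 2 / 5)

/-- item stmt-MatrixMultiplication-8162 · support · rank 9 · open · by planner
sources: ChristandlVranaZuiddam2023, BurgisserClausenShokrollahi1997
[support] Lower frame making "flat" mean "= 27": 27 ≤ R~(J), from conciseness (all three flattening
ranks are 27, exact computation this session) and `flatteningRank_le_asymptoticRank` (in tree).
[difficulty: provable-now] -/
@[route_item "route-MatrixMultiplication-CartanCubic"]
def E6LowerFrame : Prop :=
  let J : Fin 3 × (Fin 3 × Fin 3) → Fin 3 × (Fin 3 × Fin 3) → Fin 3 × (Fin 3 × Fin 3) → ℂ := fun a b c => if a.1 = b.1 ∧ b.1 = c.1 then ((if b.2.1 = a.2.1 + 1 ∧ c.2.1 = a.2.1 + 2 then (1 : ℂ) else 0) - (if b.2.1 = a.2.1 + 2 ∧ c.2.1 = a.2.1 + 1 then 1 else 0)) * ((if b.2.2 = a.2.2 + 1 ∧ c.2.2 = a.2.2 + 2 then (1 : ℂ) else 0) - (if b.2.2 = a.2.2 + 2 ∧ c.2.2 = a.2.2 + 1 then 1 else 0)) else if b.1 = a.1 + 1 ∧ c.1 = a.1 + 2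 then (if a.2.2 = b.2.1 ∧ b.2.2 = c.2.1 ∧ c.2.2 = a.2.1 then -1 else 0) else if b.1 = a.1 + 2 ∧ c.1 = a.1 + 1 then (if a.2.2 = c.2.1 ∧ c.2.2 = b.2.1 ∧ b.2.2 = a.2.1 then -1 else 0) else 0; (27 : ℝ) ≤ Literature.Computability.AlgebraicComplexity.asymptoticRank J

/-- item stmt-MatrixMultiplication-8163 · support · rank 9 · open · by planner
sources: LandsbergOttaviani2015, ConnerHarperLandsberg2019, ConnerGesmundoLandsbergVentura2022
[support] Calibration of the drop E6Flat needs: bR(J) ≥ 47, by the Landsberg–Ottaviani Koszul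
flattening with p = 3 on a generic 7-dimensional quotient of leg 1 (matrix 945 × 945 of rank ≥ 924,
computed mod 1000003 this session; 924/20 = 46.2); p = 1, 2 give 39 and 45; larger p can certify at
most 52. A rank certificate in Lean (the tree has Koszul-flattening infrastructure:
KoszulFlatteningBorderRank, BorderRankCWKoszul*). [difficulty: M] -/
@[route_item "route-MatrixMultiplication-CartanCubic"]
def E6KoszulBound : Prop :=
  let J : Fin 3 × (Fin 3 × Fin 3) → Fin 3 × (Fin 3 × Fin 3) → Fin 3 × (Fin 3 × Fin 3) → ℂ := fun a b c => if a.1 = b.1 ∧ b.1 = c.1 then ((if b.2.1 = a.2.1 + 1 ∧ c.2.1 = a.2.1 + 2 then (1 : ℂ) else 0) - (if b.2.1 = a.2.1 + 2 ∧ c.2.1 = a.2.1 + 1 then 1 else 0)) * ((if b.2.2 = a.2.2 + 1 ∧ c.2.2 = a.2.2 + 2 then (1 : ℂ) else 0) - (if b.2.2 = a.2.2 + 2 ∧ c.2.2 = a.2.2 + 1 then 1 else 0)) else if b.1 = a.1 + 1 ∧ c.1 = a.1 + 2 then (if a.2.2 = b.2.1 ∧ b.2.2 = c.2.1 ∧ c.2.2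 = a.2.1 then -1 else 0) else if b.1 = a.1 + 2 ∧ c.1 = a.1 + 1 then (if a.2.2 = c.2.1 ∧ c.2.2 = b.2.1 ∧ b.2.2 = a.2.1 then -1 else 0) else 0; 47 ≤ Literature.Computability.AlgebraicComplexity.algBorderRank J

/-- item stmt-MatrixMultiplication-8164 · assembly · rank 1 · open · by planner
sources: Schonhage1981, AlmanDuanVassilevskaWilliamsXuXuZhou2025, Blaser2013, Alman2021
[assembly] E6Flat → E6ThreeProducts → MatrixMultiplication (ω(ℂ) = 2), via the asymptotic-rank ASI,
monotonicity of R~ under degeneration and Kronecker powers, and ω ≥ 2. -/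
@[route_item "route-MatrixMultiplication-CartanCubic"]
def Assembly : Prop :=
  E6Flat → E6ThreeProducts → MatrixMultiplication

/-! D-0027 §2.1 — DECIDING THEOREM (planner-authored via `route open/edit --closes-file`; by planner-rbadge-MatrixMultiplication-CartanCubi-625552a0-g2-0 2026-08-15T16:16:18Z):
its hypotheses are this route's items and its conclusion the sub-problem Statement (glue_lint), and it elaborates with this file. -/

@[closes "route-MatrixMultiplication-CartanCubic"] theorem closes (hFlat : E6Flat) (hVal : E6ThreeProducts) : MatrixMultiplication := by
  -- Abstract over the explicit Cartan tensor `J`: only `R~(J) ≤ 27` and the degeneration rate matter.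
  suffices key : ∀ J : Fin 3 × (Fin 3 × Fin 3) → Fin 3 × (Fin 3 × Fin 3) → Fin 3 × (Fin 3 × Fin 3) → ℂ,
      Literature.Computability.AlgebraicComplexity.asymptoticRank J ≤ 27 →
      (∀ ε : ℝ, 0 < ε → ∃ N k m : ℕ, 1 ≤ N ∧ (3 : ℝ) ^ ((1 - ε) * N) ≤ m ∧
        (27 : ℝ) ^ ((1 - ε) * N) ≤ (k : ℝ) * (m : ℝ) ^ 2 ∧
        Literature.Barriers.MatrixMultiplication.PolyDegeneratesTo
          (Literature.Computability.AlgebraicComplexity.kroneckerPow J N)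
          (Literature.Computability.AlgebraicComplexity.matMulDirectSum ℂ
            (fun _ : Fin k => m) (fun _ => m) (fun _ => m))) →
      MatrixMultiplication by
    exact key _ hFlat hVal
  intro J hR hV
  rw [MatrixMultiplication_iff]
  have hw2 : 2 ≤ Literature.Computability.AlgebraicComplexity.omega ℂ :=
    Literature.Computability.AlgebraicComplexity.omega_two_le ℂ
  have hw3 : Literature.Computability.AlgebraicComplexity.omega ℂ ≤ 3 :=
    Literature.Computability.AlgebraicComplexity.omega_le_three' ℂ
  refine le_antisymm ?_ hw2
  -- the rate inequality `(1 - ε) (ω - 2) ≤ 3 ε` for every `ε > 0`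
  have hmain : ∀ ε : ℝ, 0 < ε →
      (1 - ε) * (Literature.Computability.AlgebraicComplexity.omega ℂ - 2) ≤ 3 * ε := by
    intro ε hε
    obtain ⟨N, k, m, hN, hm, hkm, hdeg⟩ := hV ε hε
    have hN0 : 0 < N := hN
    have hNr : (0 : ℝ) < N := by exact_mod_cast hN0
    have h3t : (0 : ℝ) < (3 : ℝ) ^ ((1 - ε) * N) := Real.rpow_pos_of_pos (by norm_num) _
    have hm0 : (0 : ℝ) < m := h3t.trans_le hm
    -- Schönhage's asymptotic sum inequality (asymptotic-rank form) for `k` copies of `⟨m,m,m⟩`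
    have hASI := Literature.Computability.AlgebraicComplexity.sum_rpow_omega_le_asymptoticRank ℂ
      (fun _ : Fin k => m) (fun _ => m) (fun _ => m)
    simp only [Finset.sum_const, Finset.card_univ, Fintype.card_fin, nsmul_eq_mul] at hASI
    have hcube : (((m * m * m : ℕ)) : ℝ) ^ (Literature.Computability.AlgebraicComplexity.omega ℂ / 3) =
        (m : ℝ) ^ Literature.Computability.AlgebraicComplexity.omega ℂ := by
      push_cast
      rw [show (m : ℝ) * m * m = (m : ℝ) ^ (3 : ℕ) by ring, ← Real.rpow_natCast,
        ← Real.rpow_mul (Nat.cast_nonneg _)]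
      congr 1; push_cast; ring
    rw [hcube] at hASI
    -- `k m^ω ≤ R~(⊕ ⟨m,m,m⟩) ≤ R~(J^⊠N) ≤ R~(J)^N ≤ 27^N`
    have hchain : (k : ℝ) * (m : ℝ) ^ Literature.Computability.AlgebraicComplexity.omega ℂ ≤ (27 : ℝ) ^ N :=
      calc (k : ℝ) * (m : ℝ) ^ Literature.Computability.AlgebraicComplexity.omega ℂ
          ≤ Literature.Computability.AlgebraicComplexity.asymptoticRank
              (Literature.Computability.AlgebraicComplexity.matMulDirectSum ℂ
                (fun _ : Fin k => m) (fun _ => m) (fun _ => m)) := hASI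
        _ ≤ Literature.Computability.AlgebraicComplexity.asymptoticRank
              (Literature.Computability.AlgebraicComplexity.kroneckerPow J N) :=
            Literature.Barriers.MatrixMultiplication.asymptoticRank_le_of_polyDegeneratesTo hdeg
        _ ≤ Literature.Computability.AlgebraicComplexity.asymptoticRank J ^ N :=
            Literature.Barriers.MatrixMultiplication.asymptoticRank_kroneckerPow_le J hN0
        _ ≤ (27 : ℝ) ^ N :=
            pow_le_pow_left₀ (Literature.Computability.AlgebraicComplexity.asymptoticRank_nonneg J) hR N
    -- `27^{(1-ε)N} (3^{(1-ε)N})^{ω-2} ≤ k m² m^{ω-2} = k m^ω`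
    have hw2' : 0 ≤ Literature.Computability.AlgebraicComplexity.omega ℂ - 2 := by linarith
    have hlow : (27 : ℝ) ^ ((1 - ε) * N) * ((3 : ℝ) ^ ((1 - ε) * N)) ^
          (Literature.Computability.AlgebraicComplexity.omega ℂ - 2) ≤
        (k : ℝ) * (m : ℝ) ^ Literature.Computability.AlgebraicComplexity.omega ℂ := by
      have h1 : ((3 : ℝ) ^ ((1 - ε) * N)) ^ (Literature.Computability.AlgebraicComplexity.omega ℂ - 2) ≤
          (m : ℝ) ^ (Literature.Computability.AlgebraicComplexity.omega ℂ - 2) :=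
        Real.rpow_le_rpow h3t.le hm hw2'
      have h2 : (m : ℝ) ^ Literature.Computability.AlgebraicComplexity.omega ℂ =
          (m : ℝ) ^ 2 * (m : ℝ) ^ (Literature.Computability.AlgebraicComplexity.omega ℂ - 2) := by
        rw [← Real.rpow_natCast (m : ℝ) 2, ← Real.rpow_add hm0]
        congr 1; push_cast; ring
      rw [h2, ← mul_assoc]
      exact mul_le_mul hkm h1 (Real.rpow_nonneg h3t.le _)
        (mul_nonneg (Nat.cast_nonneg _) (pow_nonneg hm0.le _))
    -- everything as a power of `3`
    have h27 : (3 : ℝ) ^ (3 : ℝ) = 27 := by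
      have : (3 : ℝ) ^ ((3 : ℕ) : ℝ) = 27 := by rw [Real.rpow_natCast]; norm_num
      exact_mod_cast this
    have h27N : (27 : ℝ) ^ N = (3 : ℝ) ^ (3 * (N : ℝ)) := by
      rw [← Real.rpow_natCast, Real.rpow_mul (by norm_num : (0 : ℝ) ≤ 3), h27]
    have h27t : (27 : ℝ) ^ ((1 - ε) * N) = (3 : ℝ) ^ (3 * ((1 - ε) * N)) := by
      rw [Real.rpow_mul (by norm_num : (0 : ℝ) ≤ 3), h27]
    have h3t' : ((3 : ℝ) ^ ((1 - ε) * N)) ^ (Literature.Computability.AlgebraicComplexity.omega ℂ - 2) =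
        (3 : ℝ) ^ (((1 - ε) * N) * (Literature.Computability.AlgebraicComplexity.omega ℂ - 2)) :=
      (Real.rpow_mul (by norm_num : (0 : ℝ) ≤ 3) _ _).symm
    have hexp' : (3 : ℝ) ^ (3 * ((1 - ε) * N) + ((1 - ε) * N) *
          (Literature.Computability.AlgebraicComplexity.omega ℂ - 2)) ≤ (3 : ℝ) ^ (3 * (N : ℝ)) := by
      rw [Real.rpow_add (by norm_num : (0 : ℝ) < 3), ← h27t, ← h3t', ← h27N]
      exact hlow.trans hchain
    have hexp : 3 * ((1 - ε) * N) + ((1 - ε) * N) *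
        (Literature.Computability.AlgebraicComplexity.omega ℂ - 2) ≤ 3 * (N : ℝ) :=
      (Real.rpow_le_rpow_left_iff (by norm_num : (1 : ℝ) < 3)).1 hexp'
    have hX : (N : ℝ) * ((1 - ε) * (Literature.Computability.AlgebraicComplexity.omega ℂ - 2)) ≤
        (N : ℝ) * (3 * ε) := by
      linarith
    exact le_of_mul_le_mul_left hX hNr
  -- let `ε → 0`: with `ε = δ/4` and `ω ≤ 3`, `ω - 2 ≤ 3ε + ε(ω - 2) ≤ 4ε = δ`
  refine le_of_forall_pos_le_add fun δ hδ => ?_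
  have h := hmain (δ / 4) (by positivity)
  have h1 : δ / 4 * (Literature.Computability.AlgebraicComplexity.omega ℂ - 2) ≤ δ / 4 * 1 :=
    mul_le_mul_of_nonneg_left (by linarith) (by positivity)
  linarith

end Summit.MatrixMultiplication.MatrixMultiplication.Theses.CartanCubic
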